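import Summits.ResolutionOfSingularities.ResolutionOfSingularities.Theorems.EquisingularLiftEquisingularLiftNatEquimultipleStrictTransform
import Summits.ResolutionOfSingularities.ResolutionOfSingularities.Theorems.EquisingularLiftEquisingularLiftNatDoubledConeDegree
import HarnessLib

/-!
# [OURS · L1 W4.5(b) · EL♮(3)] T-E1-FIBRE: the E1 clause at the exceptional fibre of a CONE-FIBRED centre — the centre's
# fibre cone `V(Φ̄_D)` lies on the strict transform of the surface whenever `Φ_D ≡ λ·Φ` modulo `𝔪` (the JET CONDITION)

Support file of the crux chain w45b (cell `res-hironaka`, LADDER-RESOLUTION rung L, slot W4.5(b)), working crux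
**EL♮ = `Theses.EquisingularLift.EquisingularLiftNat`** (stmt-ResolutionOfSingularities-20038) and its `n = 3` child
`EquisingularLiftNatThree` (stmt-ResolutionOfSingularities-20148), registered stub `stub_elnat_three_isolated_nontc`
(K4.5e arm T route T-B (E-β′), certificate (iii) «E1 via `ℙ(TC_{q̂} D) = K_j`»). OURS; NOT a statement of any manuscript;
AI-written, weaker than expert review. Filed `--supports stmt-ResolutionOfSingularities-20148 --as helper` by res-L1-w45b-stub-3
(self-dealt object T-E1-FIBRE, STATUS 2026-08-27T09:38Z).

SETTING (ring level; the currencies of `…NatEquimultipleStrictTransform` = T-M1-EXACT and of res-L1-w45b-stub-1's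
`…NatDoubledConeDegree` = T-E1-CONE-d). `R` a ring (in use: `𝒪_{X₁,q̃}`), `c = (c₁, …, c_r)` quasi-regular generating the ideal
`I` of the SECTION `ŝ` with `R/I` a domain, `B = R[I/cᵢ]` a chart of `X₂ = Bl_ŝ X₁`, `t = cᵢ/1`; the CARRIER `E = V(h)` with
`h ≡ u·ϖ (mod I)`, `u` a unit at the point (the section is transversal to the carrier: `ŝ ∩ E = V(I, ϖ) = {q̃}`); the reduction
`θ_h : R[I/cᵢ] → (R/h)[Ī/c̄ᵢ]` (`blowupAlgebraMap` along `R → R/h`; the chart of `St(E) = Bl_{q̃} E ⊂ X₂`, kernel `h·B`,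
T-M1-EXACT with `ϖ := h`). The CENTRE is the strict transform `C = St(D)` of a hypersurface `D ⊂ E` whose equation on `E` reads
`Ḡ = Φ_D(c̄) + Ψ̄` (`Φ_D` a form of degree `m` over `R`): on the chart of `St(E)` its ideal is `(ḡ₁)`, `ḡ₁ = Φ̄_D(ē) + t̄·ψ̄`
(part 1 `…NatSmoothConeBlowupChart`), so its points over `q̃` are the primes `𝔔̄ ⊇ (c̄ᵢ/1, ḡ₁)` — the CONE `V(Φ̄_D)` in the
exceptional plane. The SURFACE `Y′ ⊆ X_{1,k}` has `K_{q̃} = (ϖ, F)` with `F ≡ u′·Φ(c)² (mod I^{2m+1} + ϖR)` (doubled cone;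
stub-1), and stub-1's `mem_strictTransformSet_of_doubledCone` says: a point `𝔔` of the chart with `Φ(c/cᵢ) ∈ 𝔔`, `cᵢ/1 ∈ 𝔔`,
`ϖ/1 ∈ 𝔔` lies on `St_τ(Y′)`. THIS FILE supplies those three memberships for the points of the centre's fibre, under the

  JET CONDITION: `Φ_D − λ·Φ` has all its coefficients in `𝔪 := I + (ϖ)` for some `λ` that is a unit at the point

(for the S-F tie cubic `Φ_D = V·T₀T₁(T₀+T₁) + W·T₂³`, `Φ = U·T₀T₁(T₀+T₁) + T₂³` this is ONE scalar condition `V ≡ W·U (mod 𝔪)`,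
`coeff_tieCubic_sub_smul_mem`; `W` carries the first-order jet of `ŝ`, which `…NatSectionWithJet` (T-JET) lets one prescribe).

* `aeval_frac_mem_map_of_coeff_mem` — coefficients in `𝔞` ⇒ `Ψ(c/cᵢ) ∈ 𝔞·B`;
* `coneTransform_mem_of_coeff_sub_mem` — `Φ_D(c/cᵢ) ∈ 𝔔`, `(Φ_D − λΦ)` with coefficients in `𝔞`, `𝔞·B ⊆ 𝔔`, `λ ∉ 𝔔` ⇒ `Φ(c/cᵢ) ∈ 𝔔`;
* **`coneCurve_mem_of_fibre`** — at a prime `𝔔 ∋ t, h` of `B` with `u, λ ∉ 𝔔` and `Φ_D(c/cᵢ) + tψ ∈ 𝔔`: `Φ(c/cᵢ) ∈ 𝔔` and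
  `ϖ/1 ∈ 𝔔`;
* **`coneCurve_mem_comap_of_fibre`** — the same read from a point `𝔔̄ ⊇ (c̄ᵢ/1, Φ̄_D(ē) + t̄ψ̄)` of the centre over `q̃` on the chart
  of `St(E)`, `𝔔 = θ_h⁻¹𝔔̄`: **`Φ(c/cᵢ) ∈ 𝔔 ∧ cᵢ/1 ∈ 𝔔 ∧ ϖ/1 ∈ 𝔔`** — exactly the inputs `(hΦQ, hci, hϖQ)` of
  `mem_strictTransformSet_of_doubledCone` (p512947): E1 holds at every point of the centre's exceptional fibre;
* `coeff_tieCubic_sub_smul_mem` — the jet condition for the tie cubic;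
* **`mem_strictTransformSet_of_coneFibre`** — the scheme reading: composed with stub-1's `mem_strictTransformSet_of_doubledCone`, a
  point of the centre's exceptional fibre (in a dictionary presentation of `𝒪_{X',x'}`) lies on `closure τ⁻¹(supp K ∖ supp J)`.

Not covered, and said so: the points of the centre's special fibre OFF `q̃` (strict transforms of the lines: E1 there is the
equimultiplicity/AVOID clause, other files), and the geometric computation of `W` from the jet of `ŝ` (by hand, LEAD-MEMO-2 §6).

References: The Stacks Project, Tags 052Q, 0BIQ; Görtz–Wedhorn, *Algebraic Geometry I* (2020), (13.19), Prop. 13.96 (2). Tree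
inputs: `…NatEquimultipleStrictTransform` (p515745), `…NatDoubledConeDegree` / `…NatDoubledConeSaturation` (p512947 / p510548,
res-L1-w45b-stub-1), `…NatConeChart` (p508912, res-type-100).
-/

set_option linter.dupNamespace false -- mandated namespace `Summit.<Summit>.<Problem>` of this single-conjunct summit

noncomputable section

namespace Summit.ResolutionOfSingularities.ResolutionOfSingularities.Cruxes.EquisingularLiftNat.Sections

open MvPolynomial IsLocalization IsLocalRing Literature.AlgebraicGeometry.Resolution

universe u

section Ring

variable {R : Type u} [CommRing R] {r : ℕ} (c : Fin r → R) (i : Fin r)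

/-- A polynomial with coefficients in an ideal `𝔞` evaluates at the chart fractions `c_l/cᵢ` into `𝔞·R[I/cᵢ]`. [folklore] -/
theorem aeval_frac_mem_map_of_coeff_mem (𝔞 : Ideal R) {Ψ : MvPolynomial (Fin r) R} (hΨ : ∀ m, Ψ.coeff m ∈ 𝔞) :
    MvPolynomial.aeval (blowupAlgebra.frac c i) Ψ ∈
      𝔞.map (algebraMap R (blowupAlgebra (Ideal.span (Set.range c)) (c i))) := by
  rw [Ψ.as_sum, map_sum]
  refine Ideal.sum_mem _ fun m _ => ?_
  rw [MvPolynomial.aeval_monomial]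
  exact Ideal.mul_mem_right _ _ (Ideal.mem_map_of_mem _ (hΨ m))

/-- **Cone comparison at a prime.** If `Φ_D − λ·Φ` has coefficients in `𝔞`, `𝔞·B ⊆ 𝔔` for a prime `𝔔` of the chart not
containing `λ/1`, and `Φ_D(c/cᵢ) ∈ 𝔔`, then `Φ(c/cᵢ) ∈ 𝔔`. [folklore] -/
theorem coneTransform_mem_of_coeff_sub_mem (𝔞 : Ideal R) (ΦD Φ : MvPolynomial (Fin r) R) (lam : R)
    (hcoeff : ∀ m, (ΦD - MvPolynomial.C lam * Φ).coeff m ∈ 𝔞)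
    (𝔔 : Ideal (blowupAlgebra (Ideal.span (Set.range c)) (c i))) [𝔔.IsPrime]
    (h𝔞 : 𝔞.map (algebraMap R (blowupAlgebra (Ideal.span (Set.range c)) (c i))) ≤ 𝔔)
    (hlam : algebraMap R (blowupAlgebra (Ideal.span (Set.range c)) (c i)) lam ∉ 𝔔)
    (hΦD : MvPolynomial.aeval (blowupAlgebra.frac c i) ΦD ∈ 𝔔) :
    MvPolynomial.aeval (blowupAlgebra.frac c i) Φ ∈ 𝔔 := by
  have hdiff := h𝔞 (aeval_frac_mem_map_of_coeff_mem c i 𝔞 hcoeff)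
  rw [map_sub, map_mul, MvPolynomial.algHom_C] at hdiff
  have hprod : algebraMap R (blowupAlgebra (Ideal.span (Set.range c)) (c i)) lam *
      MvPolynomial.aeval (blowupAlgebra.frac c i) Φ ∈ 𝔔 := by
    have := 𝔔.sub_mem hΦD hdiff
    rwa [sub_sub_cancel] at this
  exact (Ideal.IsPrime.mem_or_mem inferInstance hprod).resolve_left hlam

/-- **T-E1-FIBRE, ring core.** On the chart `B = R[I/cᵢ]` of the blow-up along the section (`c` any sequence, `I = (c)`): let
`h ≡ u·ϖ (mod I)` (the carrier, transversal to the section), `Φ_D, Φ` forms with `Φ_D − λ·Φ` having all coefficients in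
`I + (ϖ)` (JET CONDITION), and `𝔔` a prime of `B` containing `t = cᵢ/1` and `h/1` but not `u/1`, `λ/1` (a point over `q̃` on the
strict transform of the carrier) and containing `Φ_D(c/cᵢ) + t·ψ` (a point of the centre). Then `Φ(c/cᵢ) ∈ 𝔔` and `ϖ/1 ∈ 𝔔`.
[folklore; OURS assembly] [OURS · L1 W4.5b] T-E1-FIBRE toward `stub_elnat_three_isolated_nontc` (stmt-20148); NOT a statement of
the manuscript. -/
theorem coneCurve_mem_of_fibre {h u ϖ : R} (hh : h - u * ϖ ∈ Ideal.span (Set.range c))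
    (ΦD Φ : MvPolynomial (Fin r) R) (lam : R)
    (hcoeff : ∀ m, (ΦD - MvPolynomial.C lam * Φ).coeff m ∈ Ideal.span (Set.range c) ⊔ Ideal.span {ϖ})
    (𝔔 : Ideal (blowupAlgebra (Ideal.span (Set.range c)) (c i))) [𝔔.IsPrime]
    (ht : algebraMap R (blowupAlgebra (Ideal.span (Set.range c)) (c i)) (c i) ∈ 𝔔)
    (hh𝔔 : algebraMap R (blowupAlgebra (Ideal.span (Set.range c)) (c i)) h ∈ 𝔔)
    (hu : algebraMap R (blowupAlgebra (Ideal.span (Set.range c)) (c i)) u ∉ 𝔔)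
    (hlam : algebraMap R (blowupAlgebra (Ideal.span (Set.range c)) (c i)) lam ∉ 𝔔)
    (ψ : blowupAlgebra (Ideal.span (Set.range c)) (c i))
    (hg : MvPolynomial.aeval (blowupAlgebra.frac c i) ΦD +
      algebraMap R (blowupAlgebra (Ideal.span (Set.range c)) (c i)) (c i) * ψ ∈ 𝔔) :
    MvPolynomial.aeval (blowupAlgebra.frac c i) Φ ∈ 𝔔 ∧
      algebraMap R (blowupAlgebra (Ideal.span (Set.range c)) (c i)) ϖ ∈ 𝔔 := by
  -- `I·B = (t) ⊆ 𝔔`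
  have hIB : (Ideal.span (Set.range c)).map (algebraMap R (blowupAlgebra (Ideal.span (Set.range c)) (c i))) ≤ 𝔔 := by
    rw [map_blowupAlgebra_eq_span (blowupAlgebra.mem_span_range c i), Ideal.span_singleton_le_iff_mem]
    exact ht
  -- `ϖ/1 ∈ 𝔔`: `h - uϖ ∈ I·B ⊆ 𝔔` and `h ∈ 𝔔`, `u ∉ 𝔔`
  have hϖ : algebraMap R (blowupAlgebra (Ideal.span (Set.range c)) (c i)) ϖ ∈ 𝔔 := by
    have h1 := hIB (Ideal.mem_map_of_mem _ hh)
    rw [map_sub, map_mul] at h1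
    have h2 : algebraMap R (blowupAlgebra (Ideal.span (Set.range c)) (c i)) u *
        algebraMap R (blowupAlgebra (Ideal.span (Set.range c)) (c i)) ϖ ∈ 𝔔 := by
      have := 𝔔.sub_mem hh𝔔 h1
      rwa [sub_sub_cancel] at this
    exact (Ideal.IsPrime.mem_or_mem inferInstance h2).resolve_left hu
  refine ⟨?_, hϖ⟩
  -- `(I + (ϖ))·B ⊆ 𝔔`
  have h𝔞 : (Ideal.span (Set.range c) ⊔ Ideal.span {ϖ}).map
      (algebraMap R (blowupAlgebra (Ideal.span (Set.range c)) (c i))) ≤ 𝔔 := by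
    rw [Ideal.map_sup]
    refine sup_le hIB ?_
    rw [Ideal.map_span, Set.image_singleton, Ideal.span_singleton_le_iff_mem]
    exact hϖ
  -- `Φ_D(c/cᵢ) ∈ 𝔔`
  have hΦD : MvPolynomial.aeval (blowupAlgebra.frac c i) ΦD ∈ 𝔔 := by
    have := 𝔔.sub_mem hg (𝔔.mul_mem_right ψ ht)
    rwa [add_sub_cancel_right] at this
  exact coneTransform_mem_of_coeff_sub_mem c i _ ΦD Φ lam hcoeff 𝔔 h𝔞 hlam hΦD

/-- **T-E1-FIBRE read from the strict transform of the carrier.** With `θ_h : R[I/cᵢ] → (R/h)[Ī/c̄ᵢ]` the reduction map along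
`R → R/h` (the chart of `St(E) = Bl_{q̃}(E)` inside `Bl_ŝ X₁`; surjective, and with kernel `h·B` when `c` is quasi-regular,
`R/I` a domain and `h ∉ I` — `ker_blowupAlgebraMap_quotient_uniformizer`, not needed here): let `𝔔̄` be a prime of `(R/h)[Ī/c̄ᵢ]` containing `c̄ᵢ/1` and `Φ̄_D(ē) + t̄·ψ̄` — a point of the centre
`C = St(D)` over `q̃`, `D ⊂ E` the hypersurface `Ḡ = Φ_D(c̄) + Ψ̄` (part 1) — and `𝔔 = θ_h⁻¹(𝔔̄)` the same point of `Bl_ŝ X₁`. Under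
the jet condition (`Φ_D − λΦ` with coefficients in `I + (ϖ)`, `u, λ ∉ 𝔔`): **`Φ(c/cᵢ) ∈ 𝔔`, `cᵢ/1 ∈ 𝔔`, `ϖ/1 ∈ 𝔔`** — the inputs
`(hΦQ, hci, hϖQ)` of `mem_strictTransformSet_of_doubledCone` (res-L1-w45b-stub-1, p512947), whence the point lies on the strict
transform `St_τ(Y′)` of a surface with tangent cone the doubled cone `u′·Φ²`: the E1 clause at the exceptional fibre of the
(E-β′) centre. [folklore; OURS assembly] [OURS · L1 W4.5b] T-E1-FIBRE; NOT a statement of the manuscript. -/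
theorem coneCurve_mem_comap_of_fibre
    {h u ϖ : R} (hh : h - u * ϖ ∈ Ideal.span (Set.range c))
    (ΦD Φ : MvPolynomial (Fin r) R) (lam : R)
    (hcoeff : ∀ m, (ΦD - MvPolynomial.C lam * Φ).coeff m ∈ Ideal.span (Set.range c) ⊔ Ideal.span {ϖ})
    (𝔔b : Ideal (blowupAlgebra (Ideal.span (Set.range fun l => Ideal.Quotient.mk (Ideal.span {h}) (c l)))
      (Ideal.Quotient.mk (Ideal.span {h}) (c i)))) [𝔔b.IsPrime]
    (htb : algebraMap (R ⧸ Ideal.span {h}) (blowupAlgebra (Ideal.span (Set.range fun l =>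
        Ideal.Quotient.mk (Ideal.span {h}) (c l))) (Ideal.Quotient.mk (Ideal.span {h}) (c i)))
      (Ideal.Quotient.mk (Ideal.span {h}) (c i)) ∈ 𝔔b)
    (ψb : blowupAlgebra (Ideal.span (Set.range fun l => Ideal.Quotient.mk (Ideal.span {h}) (c l)))
      (Ideal.Quotient.mk (Ideal.span {h}) (c i)))
    (hgb : MvPolynomial.aeval (blowupAlgebra.frac (fun l => Ideal.Quotient.mk (Ideal.span {h}) (c l)) i)
        (MvPolynomial.map (Ideal.Quotient.mk (Ideal.span {h})) ΦD) +
      algebraMap (R ⧸ Ideal.span {h}) (blowupAlgebra (Ideal.span (Set.range fun l =>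
        Ideal.Quotient.mk (Ideal.span {h}) (c l))) (Ideal.Quotient.mk (Ideal.span {h}) (c i)))
        (Ideal.Quotient.mk (Ideal.span {h}) (c i)) * ψb ∈ 𝔔b)
    (hu : algebraMap R (blowupAlgebra (Ideal.span (Set.range c)) (c i)) u ∉
      𝔔b.comap (blowupAlgebraMap (Ideal.Quotient.mk (Ideal.span {h})) (Ideal.span (Set.range c))
        (Ideal.span (Set.range fun l => Ideal.Quotient.mk (Ideal.span {h}) (c l))) (c i)
        (map_span_range_le_span_range_mk c h)))
    (hlam : algebraMap R (blowupAlgebra (Ideal.span (Set.range c)) (c i)) lam ∉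
      𝔔b.comap (blowupAlgebraMap (Ideal.Quotient.mk (Ideal.span {h})) (Ideal.span (Set.range c))
        (Ideal.span (Set.range fun l => Ideal.Quotient.mk (Ideal.span {h}) (c l))) (c i)
        (map_span_range_le_span_range_mk c h))) :
    MvPolynomial.aeval (blowupAlgebra.frac c i) Φ ∈
        𝔔b.comap (blowupAlgebraMap (Ideal.Quotient.mk (Ideal.span {h})) (Ideal.span (Set.range c))
          (Ideal.span (Set.range fun l => Ideal.Quotient.mk (Ideal.span {h}) (c l))) (c i)
          (map_span_range_le_span_range_mk c h)) ∧
      algebraMap R (blowupAlgebra (Ideal.span (Set.range c)) (c i)) (c i) ∈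
        𝔔b.comap (blowupAlgebraMap (Ideal.Quotient.mk (Ideal.span {h})) (Ideal.span (Set.range c))
          (Ideal.span (Set.range fun l => Ideal.Quotient.mk (Ideal.span {h}) (c l))) (c i)
          (map_span_range_le_span_range_mk c h)) ∧
      algebraMap R (blowupAlgebra (Ideal.span (Set.range c)) (c i)) ϖ ∈
        𝔔b.comap (blowupAlgebraMap (Ideal.Quotient.mk (Ideal.span {h})) (Ideal.span (Set.range c))
          (Ideal.span (Set.range fun l => Ideal.Quotient.mk (Ideal.span {h}) (c l))) (c i)
          (map_span_range_le_span_range_mk c h)) := by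
  haveI : (𝔔b.comap (blowupAlgebraMap (Ideal.Quotient.mk (Ideal.span {h})) (Ideal.span (Set.range c))
      (Ideal.span (Set.range fun l => Ideal.Quotient.mk (Ideal.span {h}) (c l))) (c i)
      (map_span_range_le_span_range_mk c h))).IsPrime := Ideal.IsPrime.comap _
  have hθsurj : Function.Surjective (blowupAlgebraMap (Ideal.Quotient.mk (Ideal.span {h})) (Ideal.span (Set.range c))
      (Ideal.span (Set.range fun l => Ideal.Quotient.mk (Ideal.span {h}) (c l))) (c i)
      (map_span_range_le_span_range_mk c h)) :=
    blowupAlgebraMap_surjective _ _ _ _ Ideal.Quotient.mk_surjective _ (map_span_range_eq_span_range_mk c h).ge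
  -- `t ∈ 𝔔`: `θ(t) = t̄`
  have ht : algebraMap R (blowupAlgebra (Ideal.span (Set.range c)) (c i)) (c i) ∈
      𝔔b.comap (blowupAlgebraMap (Ideal.Quotient.mk (Ideal.span {h})) (Ideal.span (Set.range c))
        (Ideal.span (Set.range fun l => Ideal.Quotient.mk (Ideal.span {h}) (c l))) (c i)
        (map_span_range_le_span_range_mk c h)) := by
    rw [Ideal.mem_comap, blowupAlgebraMap_algebraMap]
    exact htb
  -- `h ∈ 𝔔`: `θ(h) = 0`
  have hh𝔔 : algebraMap R (blowupAlgebra (Ideal.span (Set.range c)) (c i)) h ∈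
      𝔔b.comap (blowupAlgebraMap (Ideal.Quotient.mk (Ideal.span {h})) (Ideal.span (Set.range c))
        (Ideal.span (Set.range fun l => Ideal.Quotient.mk (Ideal.span {h}) (c l))) (c i)
        (map_span_range_le_span_range_mk c h)) := by
    rw [Ideal.mem_comap, blowupAlgebraMap_algebraMap, Ideal.Quotient.eq_zero_iff_mem.mpr (Ideal.mem_span_singleton_self h),
      map_zero]
    exact 𝔔b.zero_mem
  -- a lift `ψ` of `ψ̄`; then `θ(Φ_D(c/cᵢ) + tψ) = Φ̄_D(ē) + t̄ψ̄ ∈ 𝔔̄`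
  obtain ⟨ψ, hψ⟩ := hθsurj ψb
  have hg : MvPolynomial.aeval (blowupAlgebra.frac c i) ΦD +
      algebraMap R (blowupAlgebra (Ideal.span (Set.range c)) (c i)) (c i) * ψ ∈
        𝔔b.comap (blowupAlgebraMap (Ideal.Quotient.mk (Ideal.span {h})) (Ideal.span (Set.range c))
          (Ideal.span (Set.range fun l => Ideal.Quotient.mk (Ideal.span {h}) (c l))) (c i)
          (map_span_range_le_span_range_mk c h)) := by
    rw [Ideal.mem_comap, blowupAlgebraMap_strictTransform, hψ]
    exact hgb
  obtain ⟨hΦ, hϖ⟩ := coneCurve_mem_of_fibre c i hh ΦD Φ lam hcoeff _ ht hh𝔔 hu hlam ψ hg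
  exact ⟨hΦ, ht, hϖ⟩

/-! ## The jet condition for the S-F tie cubic -/

/-- **The jet condition for the tie cubic is ONE scalar congruence.** For `Φ_D = V·T₀T₁(T₀+T₁) + W·T₂³` (the centre's cone, `W`
carrying the jet of the section) and `Φ = U·T₀T₁(T₀+T₁) + T₂³` (the surface's reduced tangent cone), `Φ_D − W·Φ = (V − W·U)·T₀T₁(T₀+T₁)`;
so if `V − W·U ∈ 𝔞` then `Φ_D − W·Φ` has all its coefficients in `𝔞`. [folklore] -/
theorem coeff_tieCubic_sub_smul_mem {R : Type u} [CommRing R] (𝔞 : Ideal R) (V W U : R) (hVWU : V - W * U ∈ 𝔞)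
    (m : Fin 3 →₀ ℕ) :
    ((MvPolynomial.C V * (MvPolynomial.X 0 * MvPolynomial.X 1 * (MvPolynomial.X 0 + MvPolynomial.X 1)) +
        MvPolynomial.C W * MvPolynomial.X 2 ^ 3 : MvPolynomial (Fin 3) R) -
      MvPolynomial.C W * (MvPolynomial.C U * (MvPolynomial.X 0 * MvPolynomial.X 1 * (MvPolynomial.X 0 + MvPolynomial.X 1)) +
        MvPolynomial.X 2 ^ 3)).coeff m ∈ 𝔞 := by
  have hid : ((MvPolynomial.C V * (MvPolynomial.X 0 * MvPolynomial.X 1 * (MvPolynomial.X 0 + MvPolynomial.X 1)) +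
        MvPolynomial.C W * MvPolynomial.X 2 ^ 3 : MvPolynomial (Fin 3) R) -
      MvPolynomial.C W * (MvPolynomial.C U * (MvPolynomial.X 0 * MvPolynomial.X 1 * (MvPolynomial.X 0 + MvPolynomial.X 1)) +
        MvPolynomial.X 2 ^ 3)) =
      MvPolynomial.C (V - W * U) * (MvPolynomial.X 0 * MvPolynomial.X 1 * (MvPolynomial.X 0 + MvPolynomial.X 1)) := by
    rw [map_sub, map_mul]
    ring
  rw [hid, MvPolynomial.coeff_C_mul]
  exact Ideal.mul_mem_right _ _ hVWU

end Ring

/-! ## Scheme reading: the centre's exceptional fibre lies on the strict transform of the surface -/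

section Scheme

open CategoryTheory AlgebraicGeometry TopologicalSpace

variable {X X' : Scheme.{u}} {τ : X' ⟶ X} {J : X.IdealSheafData}

/-- **T-E1-FIBRE (scheme reading, via res-L1-w45b-stub-1's T-E1-CONE-d).** In the setting of `mem_strictTransformSet_of_doubledCone`
(p512947: `τ` a blow-up along the section ideal `J`, `J_{τ x'} = (c)`, uniformizer `ϖ ∉ (c)`, the surface `K_{τ x'} = (ϖ, F)` with
`F ≡ u·Φ(c)² (mod (c)^{2d+1} + ϖ)`, and a dictionary presentation `(i, 𝔔, χ, e)` of `𝒪_{X',x'}`), suppose `x'` is a point OVER `q̃` of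
the CONE-FIBRED CENTRE: `cᵢ/1 ∈ 𝔔`, `h/1 ∈ 𝔔` for the carrier `h ≡ v·ϖ (mod (c))` with `v/1 ∉ 𝔔`, and `Φ_D(c/cᵢ) + (cᵢ/1)·ψ ∈ 𝔔` for
the centre's cone form `Φ_D` with `Φ_D − λ·Φ` having coefficients in `(c) + (ϖ)`, `λ/1 ∉ 𝔔` (JET CONDITION). Then
**`x' ∈ closure (τ⁻¹(supp K ∖ supp J))`** — the point lies on the strict transform of the surface: clause E1 at the exceptional
fibre of the (E-β′) centre. [folklore; OURS assembly] [OURS · L1 W4.5b] T-E1-FIBRE; NOT a statement of the manuscript. -/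
theorem mem_strictTransformSet_of_coneFibre [IsLocallyNoetherian X']
    (K : X.IdealSheafData) (x' : X') {r : ℕ} (c : Fin r → X.presheaf.stalk (τ x'))
    (hcJ : Ideal.span (Set.range c) = stalkIdeal J (τ x')) (hc : IsQuasiRegular c)
    [IsDomain (X.presheaf.stalk (τ x') ⧸ Ideal.span (Set.range c))]
    {ϖ F u : X.presheaf.stalk (τ x')} (hϖ : ϖ ∉ Ideal.span (Set.range c))
    (hcbar : IsQuasiRegular fun l => Ideal.Quotient.mk (Ideal.span {ϖ}) (c l))
    [IsDomain ((X.presheaf.stalk (τ x') ⧸ Ideal.span {ϖ}) ⧸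
      Ideal.span (Set.range fun l => Ideal.Quotient.mk (Ideal.span {ϖ}) (c l)))]
    (i : Fin r) {d : ℕ} {Φ : MvPolynomial (Fin r) (X.presheaf.stalk (τ x'))} (hΦd : Φ.IsHomogeneous d)
    (hΦ : MvPolynomial.map (Ideal.Quotient.mk (Ideal.span (Set.range fun l => Ideal.Quotient.mk (Ideal.span {ϖ}) (c l))))
      (dehomogenize i (MvPolynomial.map (Ideal.Quotient.mk (Ideal.span {ϖ})) Φ)) ≠ 0)
    (hu : Ideal.Quotient.mk (Ideal.span {ϖ}) u ∉
      Ideal.span (Set.range fun l => Ideal.Quotient.mk (Ideal.span {ϖ}) (c l)))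
    (hF : F - u * MvPolynomial.eval c Φ ^ 2 ∈ Ideal.span (Set.range c) ^ (2 * d + 1) ⊔ Ideal.span {ϖ})
    (hK : stalkIdeal K (τ x') = Ideal.span {ϖ, F})
    (𝔔 : PrimeSpectrum (blowupAlgebra (Ideal.span (Set.range c)) (c i)))
    (χ : blowupAlgebra (Ideal.span (Set.range c)) (c i) →+* X'.presheaf.stalk x')
    (e : X'.presheaf.stalk x' ≃+* Localization.AtPrime 𝔔.asIdeal)
    (hχ : ∀ a, χ (algebraMap _ _ a) = (τ.stalkMap x').hom a)
    (he : ∀ b, e (χ b) = algebraMap _ (Localization.AtPrime 𝔔.asIdeal) b)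
    -- the point lies over `q̃` on the strict transform of the carrier `h ≡ v ϖ (mod (c))`
    {h v : X.presheaf.stalk (τ x')} (hh : h - v * ϖ ∈ Ideal.span (Set.range c))
    (hci : algebraMap _ (blowupAlgebra (Ideal.span (Set.range c)) (c i)) (c i) ∈ 𝔔.asIdeal)
    (hhQ : algebraMap _ (blowupAlgebra (Ideal.span (Set.range c)) (c i)) h ∈ 𝔔.asIdeal)
    (hvQ : algebraMap _ (blowupAlgebra (Ideal.span (Set.range c)) (c i)) v ∉ 𝔔.asIdeal)
    -- … and on the cone-fibred centre, whose cone form satisfies the jet condition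
    (ΦD : MvPolynomial (Fin r) (X.presheaf.stalk (τ x'))) (lam : X.presheaf.stalk (τ x'))
    (hcoeff : ∀ m, (ΦD - MvPolynomial.C lam * Φ).coeff m ∈ Ideal.span (Set.range c) ⊔ Ideal.span {ϖ})
    (hlam : algebraMap _ (blowupAlgebra (Ideal.span (Set.range c)) (c i)) lam ∉ 𝔔.asIdeal)
    (ψ : blowupAlgebra (Ideal.span (Set.range c)) (c i))
    (hg : MvPolynomial.aeval (blowupAlgebra.frac c i) ΦD +
      algebraMap _ (blowupAlgebra (Ideal.span (Set.range c)) (c i)) (c i) * ψ ∈ 𝔔.asIdeal) :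
    x' ∈ closure (τ ⁻¹' ((K.support : Set X) \ (J.support : Set X))) := by
  obtain ⟨hΦQ, hϖQ⟩ := coneCurve_mem_of_fibre c i hh ΦD Φ lam hcoeff 𝔔.asIdeal hci hhQ hvQ hlam ψ hg
  exact mem_strictTransformSet_of_doubledCone K x' c hcJ hc hϖ hcbar i hΦd hΦ hu hF hK 𝔔 χ e hχ he hΦQ hci hϖQ

end Scheme

end Summit.ResolutionOfSingularities.ResolutionOfSingularities.Cruxes.EquisingularLiftNat.Sections

end
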